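import Summits.AtomisticToContinuum.BoseEinsteinCondensation.Theorems.BECInsertionCorrectorStaticResponseBoundModulationToolkit
import HarnessLib

/-!
# The modulated ground-state energy is maximal at zero coupling (stub `stub_modInfTranslate`,
# line `uv-thomson-force-wave`, crux `BECInsertionCorrector.StaticResponseBound`,
# item stmt-AtomisticToContinuum-12057)

For `k ≠ 0` the modulated ground-state energy
`E(t) = inf {E_w(Φ) + t⟨∑ⱼcos(p·xⱼ)⟩_Φ : Φ periodic, finite energy}` of `H_w + tV_p` at fixed
`(N, L)`, `p = 2πk/L`, satisfies `E(t) ≤ E(0)` for every `t`: the half-wavelength translate `Ψ`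
of a finite-energy state `Φ` (`exists_translate_cosMean_eq_neg`) has the same energy and the
opposite density-wave mean, so `min(t⟨∑cos⟩_Φ, t⟨∑cos⟩_Ψ) ≤ 0`. This is the hypothesis
`hmax : ∀ t, E t ≤ E 0` of the maximum-principle glue `modulationBound_of_curvature`.

References: [Kato1966] VII §3 (first-order perturbation of an isolated eigenvalue vanishes by
symmetry).
-/

noncomputable section

namespace Summit.AtomisticToContinuum.BoseEinsteinCondensation.Cruxes.StaticResponseBound.UvThomsonForceWave

open MeasureTheory Filter
open scoped ENNReal NNReal BigOperators Topology
open Literature.MathematicalPhysics.QuantumManyBody.BoseGas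
open Summit.AtomisticToContinuum.BoseEinsteinCondensation.Theses.BECInsertionCorrector
open Summit.AtomisticToContinuum.BoseEinsteinCondensation.Theorems.StaticResponseBound.Negative

variable {N : ℕ} {L : ℝ}

/-- Every member of the modulated family is `≥ -|t|·N`: `E_w(Φ).toReal ≥ 0` and
`|⟨∑ⱼcos(p·xⱼ)⟩_Φ| ≤ N` (`abs_cosMean_le`). [folklore] -/
theorem neg_abs_mul_le_energy_add_mul_cosMean (w : ℝ → ℝ≥0∞) (k : Fin 3 → ℤ) (t : ℝ)
    (Φ : PeriodicTrialState N L) :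
    -(|t| * N) ≤ (periodicEnergy w Φ).toReal + t * cosMean L k Φ := by
  have h1 : 0 ≤ (periodicEnergy w Φ).toReal := ENNReal.toReal_nonneg
  have h2 : |cosMean L k Φ| ≤ N := abs_cosMean_le k Φ
  have h3 : |t * cosMean L k Φ| ≤ |t| * N := by
    rw [abs_mul]
    exact mul_le_mul_of_nonneg_left h2 (abs_nonneg t)
  have h4 := neg_abs_le (t * cosMean L k Φ)
  linarith

/-- The modulated family over the finite-energy periodic states is bounded below (by `-|t|·N`),
so its real infimum is a conditionally complete infimum. [folklore] -/
theorem bddBelow_range_energy_add_mul_cosMean (w : ℝ → ℝ≥0∞) (k : Fin 3 → ℤ) (t : ℝ) :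
    BddBelow (Set.range fun Φ : {Φ : PeriodicTrialState N L // periodicEnergy w Φ ≠ ⊤} =>
      (periodicEnergy w Φ.1).toReal + t * cosMean L k Φ.1) := by
  refine ⟨-(|t| * N), ?_⟩
  rintro _ ⟨Φ, rfl⟩
  exact neg_abs_mul_le_energy_add_mul_cosMean w k t Φ.1

/-- **`E(t) ≤ E(0)` for `k ≠ 0` (registered stub `stub_modInfTranslate`).** The modulated
ground-state energy `E(t) = inf {E_w(Φ).toReal + t⟨∑ⱼcos(p·xⱼ)⟩_Φ : E_w(Φ) < ∞}` over the
periodic `C¹` core at fixed `(N, L)`, `L > 0`, `p = 2πk/L`, `k ≠ 0`, is maximal at `t = 0`: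
for each finite-energy `Φ` the half-wavelength translate `Ψ` (`exists_translate_cosMean_eq_neg`)
has `E_w(Ψ) = E_w(Φ)` and `⟨∑cos⟩_Ψ = -⟨∑cos⟩_Φ`, so one of `Φ, Ψ` witnesses
`E(t) ≤ E_w(Φ).toReal`; if the core has no finite-energy state both sides are the junk `0`.
[folklore] -/
theorem stub_modInfTranslate :
    ∀ (w : ℝ → ℝ≥0∞) (N : ℕ) (L : ℝ), 0 < L → ∀ k : Fin 3 → ℤ, k ≠ 0 → ∀ t : ℝ,
      (⨅ Φ : {Φ : PeriodicTrialState N L // periodicEnergy w Φ ≠ ⊤},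
          ((periodicEnergy w Φ.1).toReal + t * cosMean L k Φ.1)) ≤
        (⨅ Φ : {Φ : PeriodicTrialState N L // periodicEnergy w Φ ≠ ⊤},
          ((periodicEnergy w Φ.1).toReal + 0 * cosMean L k Φ.1)) := by
  intro w N L hL k hk t
  rcases isEmpty_or_nonempty {Φ : PeriodicTrialState N L // periodicEnergy w Φ ≠ ⊤} with hE | hne
  · rw [Real.iInf_of_isEmpty, Real.iInf_of_isEmpty]
  have hbdd := bddBelow_range_energy_add_mul_cosMean (N := N) (L := L) w k t
  refine le_ciInf fun Φ => ?_
  obtain ⟨Ψ, -, hEΨ, hcos⟩ := exists_translate_cosMean_eq_neg hL hk Φ.1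
  have hΨ : periodicEnergy w Ψ ≠ ⊤ := by
    rw [hEΨ w]
    exact Φ.2
  rcases le_or_gt 0 (t * cosMean L k Φ.1) with h | h
  · calc (⨅ Φ : {Φ : PeriodicTrialState N L // periodicEnergy w Φ ≠ ⊤},
          ((periodicEnergy w Φ.1).toReal + t * cosMean L k Φ.1))
        ≤ (periodicEnergy w Ψ).toReal + t * cosMean L k Ψ := ciInf_le hbdd ⟨Ψ, hΨ⟩
      _ ≤ (periodicEnergy w Φ.1).toReal + 0 * cosMean L k Φ.1 := by
          rw [hEΨ w, hcos, zero_mul, mul_neg]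
          linarith
  · calc (⨅ Φ : {Φ : PeriodicTrialState N L // periodicEnergy w Φ ≠ ⊤},
          ((periodicEnergy w Φ.1).toReal + t * cosMean L k Φ.1))
        ≤ (periodicEnergy w Φ.1).toReal + t * cosMean L k Φ.1 := ciInf_le hbdd Φ
      _ ≤ (periodicEnergy w Φ.1).toReal + 0 * cosMean L k Φ.1 := by
          rw [zero_mul]
          linarith

end Summit.AtomisticToContinuum.BoseEinsteinCondensation.Cruxes.StaticResponseBound.UvThomsonForceWave

end
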